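import Summits.CriticalPhenomena.PercolationContinuityZ3.Theorems.Transplant.Bcc111HubKit
import HarnessLib

/-!
# The bcc (111)-films `F_m(bcc)`, exit-form routing certificate VI⁵: the `K_{2,3}` ELEVATOR HUB at thickness `m ≥ 5` (both extremes of the hub column kept)

builds on p205010 (kernel theorem, internal audit signed; external expert review pending) — NOT used in this file.
Lane `prim-bschramm`, seat `prim-bschramm-p2` (gen 48; class C1b, METHOD = input substitution; memo `HOME/bschramm/P2-LATTICES.md` §159); helper file
(`--supports stmt-CriticalPhenomena-4575 --as helper`).  For a hub slot `(Q, i, up)` of the planar model («Bcc111ClawModel».`hubCols`: `b`-column `Q ∓ uᵢ`,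
chain-port columns `Q ± u_j`, `Q ± u_k`, exit columns `Q ∓ u_j`, `Q ∓ u_k`) this file builds the SEVEN HUB VERTICES of the film: `y = (Q, h)` and `n = (Q, h ± 3)`
over the hub column (`h` the base level of the column for an up-hub, its top level for a down-hub), `b = (Q ∓ uᵢ, h ± 2)`, the chain ports `p_j = (Q ± u_j, h ± 1)`,
`p_k`, and the first vertices `x_j = (Q ∓ u_j, h ± 2)`, `x_k` of the exit legs — with the `K_{2,3}` adjacencies `y, b ∼ p_j, p_k, n` and `n ∼ x_j, x_k` (two
vertices of a (111)-film have at most two common neighbours through planar steps; the ELEVATOR `y ∼ n` supplies the third), their columns, their levels in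
`[1, m−1]` (but `y`, whose extreme level is admissible because the slot's extreme vertex is not removed) and the membership of `y, b, n` in the rerouting set.
At `m = 5` the elevator port `n = (Q, h ± 3)` may be the top or the bottom vertex of the hub column; it is cleared when BOTH extreme vertices over `Q` are kept
(«Bcc111ClawTable5».`clawH5`).  `HubFacts5` (= «Bcc111HubKit».`HubFacts` without the interior-level fields of `n`, `b`) and **`exists_hubFacts5`** (`m ≥ 5`).
[cite: DuminilCopinSidoraviciusTassion2016, §2.3 (proof of Fact 2: the three disjoint paths γ_u, γ_v, γ_w)] [cite: ConwaySloane1999, Ch. 4 §7.1]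
-/

noncomputable section

namespace Summit.CriticalPhenomena.PercolationContinuityZ3.Theorems.Transplant

namespace Bcc111

open MeasureTheory Literature.Probability.Percolation Literature.Probability.LatticeModels SimpleGraph
open Slab111 (lev)
open BccClawX (Pt rel)
open Bcc111Claw (tnZ inRB inDB rem0 remM uvec others scale hubCols)
open scoped Classical

variable {m : ℕ}

/-! ## The hub vertices at `m ≥ 5` -/

/-- **THE HUB VERTICES of a slot at `m ≥ 5`** (as «Bcc111HubKit».`HubFacts`, without the interior-level conditions on `n` and `b`). [cite: DuminilCopinSidoraviciusTassion2016, §2.3 (proof of Fact 2)] -/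
structure HubFacts5 (m : ℕ) (z : Site 2) (WR : Set (bfilm m)) (Q bc F0 F1 X0 X1 : Pt) (y b n p0 p1 x0 x1 : bfilm m) : Prop where
  yWR : y ∈ WR
  bWR : b ∈ WR
  nWR : n ∈ WR
  y_ne_b : y ≠ b
  y_ne_n : y ≠ n
  b_ne_n : b ≠ n
  shy : rel z (sh y) = Q
  shb : rel z (sh b) = bc
  shn : rel z (sh n) = Q
  shp0 : rel z (sh p0) = F0
  shp1 : rel z (sh p1) = F1
  shx0 : rel z (sh x0) = X0
  shx1 : rel z (sh x1) = X1
  yn : (film m).Adj y n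
  bn : (film m).Adj b n
  yp0 : (film m).Adj y p0
  yp1 : (film m).Adj y p1
  bp0 : (film m).Adj b p0
  bp1 : (film m).Adj b p1
  nx0 : (film m).Adj n x0
  nx1 : (film m).Adj n x1
  levp0 : 1 ≤ lev (pt p0) ∧ lev (pt p0) ≤ (m : ℤ) - 1
  levp1 : 1 ≤ lev (pt p1) ∧ lev (pt p1) ≤ (m : ℤ) - 1
  levx0 : 1 ≤ lev (pt x0) ∧ lev (pt x0) ≤ (m : ℤ) - 1
  levx1 : 1 ≤ lev (pt x1) ∧ lev (pt x1) ≤ (m : ℤ) - 1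

/-- **THE HUB VERTICES EXIST AT `m ≥ 5`** when both extreme vertices of the hub column are kept (else as «Bcc111HubKit»; for every hub slot `(Q, i, up)` whose hub column and `b`-column are rerouting columns and whose extreme vertex over `Q` is
not removed (up-hub: bottom; down-hub: top): up-hub `y = (Q, h)` at the base level `h ∈ [0,2]` of `Q`, `n = (Q, h+3)`, `b = (Q − uᵢ, h+2)`, ports `(Q + u_j, h+1)`,
`(Q + u_k, h+1)`, exit first vertices `(Q − u_j, h+2)`, `(Q − u_k, h+2)`; down-hub the mirror image from the top level of `Q`). [cite: DuminilCopinSidoraviciusTassion2016, §2.3 (proof of Fact 2)] -/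
theorem exists_hubFacts5 (hm : 5 ≤ m) (z : Site 2) {tR tD sR sD : ℕ} (htRD : tR ≤ tD) (hsRD : sR ≤ sD) {Q : Pt} {i : ℕ} {up : Bool}
    {bc F0 F1 X0 X1 : Pt} (hh : hubCols Q i up = (bc, F0, F1, X0, X1)) (hi : i ≤ 2) (hQ : inRB (min tR 3) (min sR 3) Q = true)
    (hQ0 : rem0 (min tR 3) (min sR 3) Q = false) (hQm : remM (min tR 3) (min sR 3) Q = false) (hbc : inRB (min tR 3) (min sR 3) bc = true) :
    ∃ y b n p0 p1 x0 x1 : bfilm m,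
      HubFacts5 m z (clearedSet m z tR tD sR sD ∩ (hexShadow m).lift (blkR 3 z tR sR)) Q bc F0 F1 X0 X1 y b n p0 p1 x0 x1 := by
  have hm' : (5 : ℤ) ≤ m := by exact_mod_cast hm
  have hm1 : 1 ≤ m := le_trans (by norm_num) hm
  obtain ⟨hj, hk, hsum⟩ := others_spec hi
  set QS : Site 2 := BccClawX.pt z Q with hQS
  set ui : Site 2 := dvec (uvec i)
  set uj : Site 2 := dvec (uvec (others i).1)
  set uk : Site 2 := dvec (uvec (others i).2)
  have hui : IsUp ui := isUp_uvec hi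
  have huj : IsUp uj := isUp_uvec hj
  have huk : IsUp uk := isUp_uvec hk
  obtain ⟨ebc, eF0, eF1, eX0, eX1⟩ := hubCols_pt z hh
  have hrel : ∀ {v : bfilm m} {P : Site 2} {p : Pt}, sh v = P → BccClawX.pt z p = P → rel z (sh v) = p := by
    intro v P p hv hp; rw [hv, ← hp, BccClawX.rel_pt]
  have hb0 := baseLev_range QS
  -- membership helpers
  have memWR : ∀ {v : bfilm m} {p : Pt}, rel z (sh v) = p → inRB (min tR 3) (min sR 3) p = true → 1 ≤ lev (pt v) → lev (pt v) ≤ (m : ℤ) - 1 →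
      v ∈ clearedSet m z tR tD sR sD ∩ (hexShadow m).lift (blkR 3 z tR sR) := by
    intro v p hv hp h1 h2; exact mem_WR_of_lev htRD hsRD (by rw [hv]; exact hp) h1 h2
  cases up with
  | true =>
    simp only [if_true, one_smul] at ebc eF0 eF1 eX0 eX1
    set h : ℤ := baseLev QS with hhdef
    have hay : Adm m QS h := adm_baseLev (le_trans (by norm_num) hm) QS
    have han : Adm m QS (h + 3) := adm_elev hay (by omega)
    have hap0 : Adm m (QS + uj) (h + 1) := adm_up hay huj (by omega)
    have hap1 : Adm m (QS + uk) (h + 1) := adm_up hay huk (by omega)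
    have hebc : QS + uj + uk = QS - ui := by
      have : ui + uj + uk = 0 := hsum
      rw [show QS - ui = QS + (uj + uk) - (ui + uj + uk) by abel, this, sub_zero, add_assoc]
    have hab : Adm m (QS - ui) (h + 2) := by
      have := adm_up hap0 huk (by omega); rwa [hebc, show h + 1 + 1 = h + 2 by ring] at this
    have hax0 : Adm m (QS - uj) (h + 3 - 1) := adm_down han huj (by omega)
    have hax1 : Adm m (QS - uk) (h + 3 - 1) := adm_down han huk (by omega)
    refine ⟨vtx m QS h, vtx m (QS - ui) (h + 2), vtx m QS (h + 3), vtx m (QS + uj) (h + 1), vtx m (QS + uk) (h + 1),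
      vtx m (QS - uj) (h + 3 - 1), vtx m (QS - uk) (h + 3 - 1), ?_⟩
    refine ⟨?_, memWR (hrel (sh_vtx hab) ebc) hbc (by rw [lev_vtx hab]; omega) (by rw [lev_vtx hab]; omega),
      ?_, ?_, ?_, ?_,
      hrel (sh_vtx hay) rfl, hrel (sh_vtx hab) ebc, hrel (sh_vtx han) rfl, hrel (sh_vtx hap0) eF0, hrel (sh_vtx hap1) eF1,
      hrel (sh_vtx hax0) eX0, hrel (sh_vtx hax1) eX1, adj_vtx_elev hay (by omega), ?_, adj_vtx_up hay huj (by omega), adj_vtx_up hay huk (by omega),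
      ?_, ?_, ?_, ?_, by rw [lev_vtx hap0]; omega, by rw [lev_vtx hap1]; omega, by rw [lev_vtx hax0]; omega, by rw [lev_vtx hax1]; omega⟩
    · -- `y ∈ WR`: level `h ∈ [0,2]`; if `h = 0` the bottom vertex over `Q` is not removed
      rw [mem_WR_iff htRD hsRD, hrel (sh_vtx hay) rfl, lev_vtx hay]
      exact ⟨hQ, fun hc => by rw [hQ0] at hc; exact Bool.false_ne_true hc.2, fun hc => by omega⟩
    · -- `n ∈ WR`: level `h + 3 ∈ [3,5]`; if `h + 3 = m` the top vertex over `Q` is not removed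
      rw [mem_WR_iff htRD hsRD, hrel (sh_vtx han) rfl, lev_vtx han]
      exact ⟨hQ, fun hc => by omega, fun hc => by rw [hQm] at hc; exact Bool.false_ne_true hc.2⟩
    · intro e; have := congrArg (fun v : bfilm m => lev (pt v)) e; simp only [lev_vtx hay, lev_vtx hab] at this; omega
    · intro e; have := congrArg (fun v : bfilm m => lev (pt v)) e; simp only [lev_vtx hay, lev_vtx han] at this; omega
    · intro e; have := congrArg (fun v : bfilm m => lev (pt v)) e; simp only [lev_vtx hab, lev_vtx han] at this; omega
    · -- `b ∼ n`: `n = b + uᵢ`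
      have := adj_vtx_up hab hui (by omega)
      rwa [sub_add_cancel, show h + 2 + 1 = h + 3 by ring] at this
    · -- `b ∼ p₀`: `b = p₀ + u_k`
      have := adj_vtx_up hap0 huk (by omega)
      rw [hebc, show h + 1 + 1 = h + 2 by ring] at this; exact this.symm
    · -- `b ∼ p₁`: `b = p₁ + u_j`
      have := adj_vtx_up hap1 huj (by omega)
      rw [show QS + uk + uj = QS + uj + uk by abel, hebc, show h + 1 + 1 = h + 2 by ring] at this; exact this.symm
    · -- `n ∼ x₀`: `n = x₀ + u_j`
      have := adj_vtx_up hax0 huj (by omega)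
      rw [sub_add_cancel, show h + 3 - 1 + 1 = h + 3 by ring] at this; exact this.symm
    · have := adj_vtx_up hax1 huk (by omega)
      rw [sub_add_cancel, show h + 3 - 1 + 1 = h + 3 by ring] at this; exact this.symm
  | false =>
    simp only [Bool.false_eq_true, if_false, neg_smul, one_smul, sub_neg_eq_add] at ebc eF0 eF1 eX0 eX1
    -- the top level `h ∈ [m−2, m]` of the hub column
    set h : ℤ := baseLev QS + 3 * (((m : ℤ) - baseLev QS) / 3) with hhdef
    have hrange : (m : ℤ) - 2 ≤ h ∧ h ≤ m := by omega
    have hay : Adm m QS h := adm_of_dvd (adm_baseLev (le_trans (by norm_num) hm) QS) ⟨((m : ℤ) - baseLev QS) / 3, by omega⟩ (by omega) hrange.2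
    have han : Adm m QS (h - 3) := adm_of_dvd hay ⟨-1, by ring⟩ (by omega) (by omega)
    have hap0 : Adm m (QS - uj) (h - 1) := adm_down hay huj (by omega)
    have hap1 : Adm m (QS - uk) (h - 1) := adm_down hay huk (by omega)
    have hebc : QS - uj - uk = QS + ui := by
      have : ui + uj + uk = 0 := hsum
      rw [show QS + ui = QS - (uj + uk) + (ui + uj + uk) by abel, this, add_zero, sub_sub]
    have hab : Adm m (QS + ui) (h - 2) := by
      have := adm_down hap0 huk (by omega); rwa [hebc, show h - 1 - 1 = h - 2 by ring] at this
    have hax0 : Adm m (QS + uj) (h - 3 + 1) := adm_up han huj (by omega)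
    have hax1 : Adm m (QS + uk) (h - 3 + 1) := adm_up han huk (by omega)
    refine ⟨vtx m QS h, vtx m (QS + ui) (h - 2), vtx m QS (h - 3), vtx m (QS - uj) (h - 1), vtx m (QS - uk) (h - 1),
      vtx m (QS + uj) (h - 3 + 1), vtx m (QS + uk) (h - 3 + 1), ?_⟩
    refine ⟨?_, memWR (hrel (sh_vtx hab) (by rw [ebc])) hbc (by rw [lev_vtx hab]; omega) (by rw [lev_vtx hab]; omega),
      ?_, ?_, ?_, ?_,
      hrel (sh_vtx hay) rfl, hrel (sh_vtx hab) (by rw [ebc]), hrel (sh_vtx han) rfl, hrel (sh_vtx hap0) (by rw [eF0, sub_eq_add_neg]),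
      hrel (sh_vtx hap1) (by rw [eF1, sub_eq_add_neg]), hrel (sh_vtx hax0) eX0, hrel (sh_vtx hax1) eX1, ?_, ?_, ?_, ?_, ?_, ?_, ?_, ?_,
      by rw [lev_vtx hap0]; omega, by rw [lev_vtx hap1]; omega, by rw [lev_vtx hax0]; omega, by rw [lev_vtx hax1]; omega⟩
    · -- `y ∈ WR`: level `h ∈ [m−2, m]`; if `h = m` the top vertex over `Q` is not removed
      rw [mem_WR_iff htRD hsRD, hrel (sh_vtx hay) rfl, lev_vtx hay]
      exact ⟨hQ, fun hc => by omega, fun hc => by rw [hQm] at hc; exact Bool.false_ne_true hc.2⟩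
    · -- `n ∈ WR`: level `h − 3 ∈ [m−5, m−3]`; if `h − 3 = 0` the bottom vertex over `Q` is not removed
      rw [mem_WR_iff htRD hsRD, hrel (sh_vtx han) rfl, lev_vtx han]
      exact ⟨hQ, fun hc => by rw [hQ0] at hc; exact Bool.false_ne_true hc.2, fun hc => by omega⟩
    · intro e; have := congrArg (fun v : bfilm m => lev (pt v)) e; simp only [lev_vtx hay, lev_vtx hab] at this; omega
    · intro e; have := congrArg (fun v : bfilm m => lev (pt v)) e; simp only [lev_vtx hay, lev_vtx han] at this; omega
    · intro e; have := congrArg (fun v : bfilm m => lev (pt v)) e; simp only [lev_vtx hab, lev_vtx han] at this; omega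
    · -- `y ∼ n` (elevator from `n`)
      have := adj_vtx_elev han (by omega); rw [sub_add_cancel] at this; exact this.symm
    · -- `b ∼ n`: `b = n + uᵢ`
      have := adj_vtx_up han hui (by omega)
      rw [show h - 3 + 1 = h - 2 by ring] at this; exact this.symm
    · -- `y ∼ p₀`
      exact adj_vtx_down hay huj (by omega)
    · exact adj_vtx_down hay huk (by omega)
    · -- `b ∼ p₀`: `b = p₀ − u_k`
      have := adj_vtx_down hap0 huk (by omega)
      rw [hebc, show h - 1 - 1 = h - 2 by ring] at this; exact this.symm
    · have := adj_vtx_down hap1 huj (by omega)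
      rw [show QS - uk - uj = QS - uj - uk by abel, hebc, show h - 1 - 1 = h - 2 by ring] at this; exact this.symm
    · -- `n ∼ x₀`: `x₀ = n + u_j`
      exact adj_vtx_up han huj (by omega)
    · exact adj_vtx_up han huk (by omega)

end Bcc111

end Summit.CriticalPhenomena.PercolationContinuityZ3.Theorems.Transplant

end
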